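import Summits.QuantumFields.YangMills.Theorems.UnitScaleTiltProp7TrueLinSourcedDefectL1
import Summits.QuantumFields.YangMills.Theorems.PoincareLipschitzTrueLinBoxLocalRows
import HarnessLib

/-!
# Route `UnitScaleTilt`, crux K1 «MinimiserStabilityRegPr» (stmt-QuantumFields-19200), route-R (β) R0 REM2ˢ, row «(n3)₂-sym» = H2-1ˢ, file N1 —
# THE SPARSE TWO-CHANNEL `ℓ¹` ENGINE: the coarse-gauge channel of the sourced structure recursion read ONLY at the sampled centres,
# `Λ_k(y) = Σ_{j<k} CM_j(G_j)(emb^{k−1−j} y)`, with LOCAL `ℓ¹` propagation of the reduced family on nested bond families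

Cell `ym3-torus` (HUMAN RULING D-0037: YM₃ on the three-torus is ladder rung R3 — not d = 4, not infinite volume, not a mass gap, not Clay), width seat `ym3-torus-px21` (gen 7),
LOCATE «H2-1ˢ» (`LOCATE-H21s-N32SYM-px21g7.md`, 19200 evidence #52).  THEOREMS ONLY (0 `def`, 0 `sorry`); `--supports stmt-QuantumFields-19200 --as helper`, count-neutral.
Nothing here claims the «(n3)₂-sym» row, `hMcomb₂`, (β), the stub, the crux, d = 4 or the mass gap.

THE POINT.  ★routeR-w6 g3's `ℓ¹` engine ✓`Prop7TrueLinSourcedDefectL1` (file 1b) bounds the sourced family `D_{j+1} = T_jD_j + R_j` through the structure split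
`D_k = G_k + P_{Ū₀^{(k)}}Λ_k` (✓A1) with the mass channel damped (`ρ₁ = L^{1−d}` per level) but the coarse-gauge channel UNDAMPED: its `sum_norm_sourcedGauge_le` reads
`Σ_y‖Λ_k(y)‖ ≤ Σ_{j<k}(d+2)L·Σ_c‖G_j(c)‖` because ✓`sum_norm_le_sum_levels` replaces the sum over the CENTRES `emb z` by the sum over ALL finer sites (✓`sum_comp_emb_le`).
For second-order sources `‖R_j‖_{ℓ¹} ≍ A·L^{−j} + B·Lʲ` this loses exactly the factor `ℓ` in the `M`-slot that the displayed row «(n3)₂-sym» needs (★routeR-w1 g9's located difficulty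
H2-1; px13 g6 2026-08-29 07:18Z).  THIS FILE keeps the sparsity: unrolling `Λ_{j+1}(z) = CM_j(G_j)(z) + Λ_j(emb z)` along `emb` shows that `Λ_k` on a site family `S_k` reads `CM_j(G_j)`
only on the image families `S_{j+1} ⊇ emb^{k−1−j}(S_k)` (§3), `CM_j(G_j)(z)` reads `G_j` only on the block `B(z)` (✓1a `norm_covCombMean_le_block`), and the reduced family there is
controlled by the sources on NESTED bond families `C_i ⊇ ⋃_{c ∈ C_{i+1}} N(c)` with the SAME damped weights as 1b (§1–§2: the pointwise rows ✓`norm_line_le`, ✓`norm_defect_le_nbhd`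
with px7 g4's local counts ✓`sum_line_bonds_le_local`, ✓`sum_nbhd_le_local`).  The localised source masses are then the consumer's business (LOCATE §4: px18 g4's ✓`sum_normSq_le_localisedMass_chain`
at level 0) — here every support family is DISPLAYED and arbitrary.

WHAT IS PROVED (ns `…Theorems.Prop7TrueLinSourcedSparseL1`; `SU`-type background of any rank, any `P`; `T_j`, `LINE_j`, `Def_j`, `CM_j` WRITTEN OUT as in 1a∕1b∕A1).
* §1 ★ `sum_norm_line_le_local` (`Σ_{c∈C}‖LINE_VZ(c)‖ ≤ (L^d)⁻¹L·Σ_{b∈S}‖Z b‖`), ★ `sum_norm_defect_le_local` (`Σ_{c∈C}‖Def_VZ(c)‖ ≤ 159α(d+2)L·2d·Σ_{b∈S}‖Z b‖`, loop windows on `C` only),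
  ★ `sum_norm_sourcedReduced_succ_le_local` (`Σ_{c∈C}‖G_{j+1}(c)‖ ≤ (ρ₁ + κ₁α)·Σ_{b∈S}‖G_j(b)‖ + Σ_{c∈C}‖R_j(c)‖`) — for ANY `C` and ANY reading set `S ⊇ ⋃_{c∈C}N(c)`.
* §2 ★★ `sum_norm_sourcedReduced_le_local` — along NESTED bond families `C_i` (`N(c) ⊆ C_i` for `c ∈ C_{i+1}`), ANY initial value:
  `Σ_{c∈C_k}‖G_k(c)‖ ≤ exp((κ₁∕ρ₁)Σ_{i<k}a_i)·(ρ₁ᵏ·Σ_{b∈C_0}‖G_0(b)‖ + Σ_{i<k}ρ₁^{k−1−i}·Σ_{c∈C_{i+1}}‖R_i(c)‖)` — 1b's ✓`sum_norm_sourcedReduced_le` is `C_i = univ`.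
* §3 ★★ `sum_norm_sourcedGauge_le_sparse` (`Σ_{y∈S_k}‖Λ_k(y)‖ ≤ Σ_{j<k}Σ_{z∈S_{j+1}}‖CM_j(G_j)(z)‖` for site families with `emb(S_{i+1}) ⊆ S_i`) and ★ `sum_norm_sourcedGauge_le_sparse_blocks`
  (`… ≤ Σ_{j<k}(d+2)L·Σ_{z∈S_{j+1}}Σ_{b : blockOf b₋ = z}‖G_j(b)‖`).
* §4 ★★★ `sum_norm_sourced_le_sparse` — THE SPARSE TWO-CHANNEL ENGINE: `Σ_c‖D_k(c)‖ ≤ ⟨1b's damped reduced-family bound⟩ + 2d·Σ_{j<k}(d+2)L·Σ_{z∈S_{j+1}}Σ_{b : blockOf b₋ = z}‖G_j(b)‖`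
  for any site families with `emb(S_{i+1}) ⊆ S_i` and `S_k = univ` (the centre chains; their geometry and the per-centre instance of §2 are the consumer's).
HONEST SCOPE.  Bookkeeping over landed bricks (1a, 1b, A1, px7 g4's local counts); no estimate of [Balaban1984PropagatorsI] ∕ [Balaban1985Averaging] beyond the cited tree theorems;
no localisation inequality, no fibre, no curvature, no member here.
References: T. Bałaban, CMP 95 (1984) 17–40 [Balaban1984PropagatorsI] ((1.11), (1.18)–(1.20) pp.19–20); CMP 98 (1985) 17–51 [Balaban1985Averaging] (Prop. 3 (124)–(126) p.36);
CMP 102 (1985) 277–309 [Balaban1985Variational] (Prop. 7 p.299); CMP 109 (1987) 249–301 [Balaban1987RG1] ((0.3)–(0.4) pp.252–253).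
-/

set_option autoImplicit false

noncomputable section

open scoped BigOperators Matrix.Norms.L2Operator

namespace Summit.QuantumFields.YangMills.Theorems.Prop7TrueLinSourcedSparseL1

open Literature.MathematicalPhysics.QuantumFieldTheory.Balaban1983to89
open Finset T4Continuum BlockAveraging AveragingRT ExpMeanLog BlockAveragingEMLLinearised BlockAveragingEMLLinearisedBackground BlockAveragingEMLProp2
open Summit.QuantumFields.YangMills.Theorems.Prop7TrueLinLineBound (norm_line_le)
open Summit.QuantumFields.YangMills.Theorems.Prop7TrueLinDefectBound (norm_defect_le_nbhd)
open Summit.QuantumFields.YangMills.Theorems.Prop7TrueLinSourcedDefectL1Rows (norm_covCombMean_le_block sourced_recursion_bound_init)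
open Summit.QuantumFields.YangMills.Theorems.Prop7TrueLinSourcedDefectL1 (sum_norm_sourcedReduced_le)
open Summit.QuantumFields.YangMills.Theorems.Prop7TrueLinSourcedStructure (norm_le_of_sourced_structure)
open Summit.QuantumFields.YangMills.Theorems.Prop7PinnedFlatCoercivity (sum_pbond_tgt_add_src)
open Summit.QuantumFields.YangMills.Theorems.PoincareLipschitzTrueLinBoxLocalRows (sum_nbhd_le_local sum_line_bonds_le_local)

variable {P : Params} {n : Type*} [Fintype n] [DecidableEq n] [Nonempty n]

/-! ## §1 ★ The local one-level `ℓ¹` rows over a sub-family `C` against a reading set `S ⊇ ⋃_{c∈C} N(c)` -/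

/-- ★ **LOCAL `ℓ¹` LINE ROW**: `Σ_{c∈C} ‖LINE_VZ(c)‖ ≤ (L^d)⁻¹·L·Σ_{b∈S} ‖Z(b)‖` for every finite family `C` of coarse bonds and every reading set `S ⊇ ⋃_{c∈C} N(c)`
(pointwise ✓`norm_line_le` + px7 g4's local `L`-to-one count ✓`sum_line_bonds_le_local`).  1a's ✓`sum_norm_line_le` is `C = univ`, `S = univ`.
[cite: Balaban1984PropagatorsI, (1.11), (1.18) pp.19-20] -/
theorem sum_norm_line_le_local {j : ℕ} (hj : j + 1 ≤ P.m + P.K) (V : GaugeField P j (Matrix.specialUnitaryGroup n ℂ)) (Z : PBond P j → Matrix n n ℂ)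
    (C : Finset (PBond P (j + 1))) (S : Finset (PBond P j))
    (hS : ∀ c ∈ C, ∀ b : PBond P j, (blockOf b.src = c.src ∨ blockOf b.src = c.tgt) → b ∈ S) :
    ∑ c ∈ C, ‖((Fintype.card (Idx P) : ℂ))⁻¹ • ∑ i : Idx P,
        ((holAt V (walk (emb c.src) (stairWord i.2.1 (off i.1))) : Matrix.specialUnitaryGroup n ℂ) : Matrix n n ℂ) *
          covWalkSum V Z (walk (walkEnd (emb c.src) (stairWord i.2.1 (off i.1))) (List.replicate P.L (c.dir, true))) *
        star ((holAt V (walk (emb c.src) (stairWord i.2.1 (off i.1))) : Matrix.specialUnitaryGroup n ℂ) : Matrix n n ℂ)‖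
      ≤ ((P.L : ℝ) ^ P.d)⁻¹ * (P.L : ℝ) * ∑ b ∈ S, ‖Z b‖ := by
  have hLd : (0 : ℝ) ≤ ((P.L : ℝ) ^ P.d)⁻¹ := by positivity
  calc _ ≤ ∑ c ∈ C, ((P.L : ℝ) ^ P.d)⁻¹ * ∑ r : Fin P.d → Fin P.L, ∑ t ∈ Finset.range P.L,
          ‖Z ⟨(fun z : Site P j => z.shift c.dir)^[t] (Site.blockSite c.src r), c.dir⟩‖ :=
        Finset.sum_le_sum fun c _ => norm_line_le V Z c
    _ = ((P.L : ℝ) ^ P.d)⁻¹ * ∑ c ∈ C, ∑ r : Fin P.d → Fin P.L, ∑ t ∈ Finset.range P.L,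
          ‖Z ⟨(fun z : Site P j => z.shift c.dir)^[t] (Site.blockSite c.src r), c.dir⟩‖ := by rw [Finset.mul_sum]
    _ ≤ ((P.L : ℝ) ^ P.d)⁻¹ * ((P.L : ℝ) * ∑ b ∈ S, ‖Z b‖) :=
        mul_le_mul_of_nonneg_left (sum_line_bonds_le_local hj C S hS (fun b => ‖Z b‖) fun b => norm_nonneg _) hLd
    _ = _ := by ring

/-- ★ **LOCAL `ℓ¹` DEFECT ROW**: if the (0.4) loop variables of `V` at the coarse bonds OF `C` are within `α ≤ 1/24` (`α < δ_N`) of `1`, then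
`Σ_{c∈C} ‖T(V)Z(c) − P_{V̄}(CM_VZ)(c) − LINE_VZ(c)‖ ≤ 159·α·(d+2)L·(2d)·Σ_{b∈S} ‖Z(b)‖` for every reading set `S ⊇ ⋃_{c∈C} N(c)`
(pointwise ✓`norm_defect_le_nbhd` + px7 g4's local multiplicity ✓`sum_nbhd_le_local`).  1a's ✓`sum_norm_defect_le` is `C = univ`, `S = univ`.
[cite: Balaban1985Averaging, Prop. 3 (124)-(126) p.36] -/
theorem sum_norm_defect_le_local {j : ℕ} (hj : j + 1 ≤ P.m + P.K) (V : GaugeField P j (Matrix.specialUnitaryGroup n ℂ)) (Z : PBond P j → Matrix n n ℂ)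
    (C : Finset (PBond P (j + 1))) (S : Finset (PBond P j))
    (hS : ∀ c ∈ C, ∀ b : PBond P j, (blockOf b.src = c.src ∨ blockOf b.src = c.tgt) → b ∈ S)
    {α : ℝ} (hα0 : 0 ≤ α) (hα : ∀ c ∈ C, ∀ i : Idx P, dist1 (loopHol V c i) ≤ α) (hα24 : α ≤ 1 / 24) (hαN : α < deltaSU n) :
    ∑ c ∈ C, ‖(fderiv ℂ (eml : (Idx P → Matrix n n ℂ) → Matrix n n ℂ) (fun i => ((loopHol V c i : Matrix.specialUnitaryGroup n ℂ) : Matrix n n ℂ))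
          (fun i => covWalkSum V Z (walk (emb c.src) (loopWord P.L c.dir (off i.1) i.2.1 i.2.2))
            * ((loopHol V c i : Matrix.specialUnitaryGroup n ℂ) : Matrix n n ℂ))
          * star ((corr (expMeanLogSU (n := n)) V c : Matrix.specialUnitaryGroup n ℂ) : Matrix n n ℂ)
        + ((corr (expMeanLogSU (n := n)) V c : Matrix.specialUnitaryGroup n ℂ) : Matrix n n ℂ)
          * covWalkSum V Z (walk (emb c.src) (List.replicate P.L (c.dir, true)))
          * star ((corr (expMeanLogSU (n := n)) V c : Matrix.specialUnitaryGroup n ℂ) : Matrix n n ℂ))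
      - ((((Fintype.card (Idx P) : ℂ))⁻¹ • ∑ i : Idx P, covWalkSum V Z (walk (emb c.src) (stairWord i.2.1 (off i.1))))
          - ((avgFun (expMeanLogSU (n := n)) V c : Matrix.specialUnitaryGroup n ℂ) : Matrix n n ℂ)
              * (((Fintype.card (Idx P) : ℂ))⁻¹ • ∑ i : Idx P, covWalkSum V Z (walk (emb c.tgt) (stairWord i.2.1 (off i.1))))
              * star ((avgFun (expMeanLogSU (n := n)) V c : Matrix.specialUnitaryGroup n ℂ) : Matrix n n ℂ))
      - ((Fintype.card (Idx P) : ℂ))⁻¹ • ∑ i : Idx P,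
          ((holAt V (walk (emb c.src) (stairWord i.2.1 (off i.1))) : Matrix.specialUnitaryGroup n ℂ) : Matrix n n ℂ) *
            covWalkSum V Z (walk (walkEnd (emb c.src) (stairWord i.2.1 (off i.1))) (List.replicate P.L (c.dir, true))) *
          star ((holAt V (walk (emb c.src) (stairWord i.2.1 (off i.1))) : Matrix.specialUnitaryGroup n ℂ) : Matrix n n ℂ)‖
      ≤ 159 * α * (((P.d + 2) * P.L : ℕ) : ℝ) * (2 * P.d) * ∑ b ∈ S, ‖Z b‖ := by
  have hK : (0 : ℝ) ≤ 159 * α * (((P.d + 2) * P.L : ℕ) : ℝ) := by positivity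
  calc _ ≤ ∑ c ∈ C, 159 * α * ((((P.d + 2) * P.L : ℕ) : ℝ) * ∑ b ∈ univ.filter (fun b : PBond P j => blockOf b.src = c.src ∨ blockOf b.src = c.tgt), ‖Z b‖) :=
        Finset.sum_le_sum fun c hc => norm_defect_le_nbhd hj V Z c (hα c hc) hα24 hαN
    _ = 159 * α * (((P.d + 2) * P.L : ℕ) : ℝ) * ∑ c ∈ C, ∑ b ∈ univ.filter (fun b : PBond P j => blockOf b.src = c.src ∨ blockOf b.src = c.tgt), ‖Z b‖ := by
        rw [Finset.mul_sum]
        exact Finset.sum_congr rfl fun c _ => by ring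
    _ ≤ 159 * α * (((P.d + 2) * P.L : ℕ) : ℝ) * (2 * P.d * ∑ b ∈ S, ‖Z b‖) :=
        mul_le_mul_of_nonneg_left (sum_nbhd_le_local C S hS (fun b => ‖Z b‖) fun b => norm_nonneg _) hK
    _ = _ := by ring

section Sourced

variable (U₀ : GaugeField P 0 (Matrix.specialUnitaryGroup n ℂ)) (R : (k : ℕ) → PBond P (k + 1) → Matrix n n ℂ)
  (G : (k : ℕ) → PBond P k → Matrix n n ℂ)
  (hGs : ∀ (k : ℕ) (c : PBond P (k + 1)), G (k + 1) c
      = (fderiv ℂ (eml : (Idx P → Matrix n n ℂ) → Matrix n n ℂ)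
            (fun i => ((loopHol (Averaging.iter (fun i => blockAvg (P := P) (j := i) (expMeanLogSU (n := n))) k U₀) c i : Matrix.specialUnitaryGroup n ℂ) : Matrix n n ℂ))
            (fun i => covWalkSum (Averaging.iter (fun i => blockAvg (P := P) (j := i) (expMeanLogSU (n := n))) k U₀) (G k) (walk (emb c.src) (loopWord P.L c.dir (off i.1) i.2.1 i.2.2))
              * ((loopHol (Averaging.iter (fun i => blockAvg (P := P) (j := i) (expMeanLogSU (n := n))) k U₀) c i : Matrix.specialUnitaryGroup n ℂ) : Matrix n n ℂ))
            * star ((corr (expMeanLogSU (n := n)) (Averaging.iter (fun i => blockAvg (P := P) (j := i) (expMeanLogSU (n := n))) k U₀) c : Matrix.specialUnitaryGroup n ℂ) : Matrix n n ℂ)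
          + ((corr (expMeanLogSU (n := n)) (Averaging.iter (fun i => blockAvg (P := P) (j := i) (expMeanLogSU (n := n))) k U₀) c : Matrix.specialUnitaryGroup n ℂ) : Matrix n n ℂ)
            * covWalkSum (Averaging.iter (fun i => blockAvg (P := P) (j := i) (expMeanLogSU (n := n))) k U₀) (G k) (walk (emb c.src) (List.replicate P.L (c.dir, true)))
            * star ((corr (expMeanLogSU (n := n)) (Averaging.iter (fun i => blockAvg (P := P) (j := i) (expMeanLogSU (n := n))) k U₀) c : Matrix.specialUnitaryGroup n ℂ) : Matrix n n ℂ))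
        - ((((Fintype.card (Idx P) : ℂ))⁻¹ • ∑ i : Idx P,
              covWalkSum (Averaging.iter (fun i => blockAvg (P := P) (j := i) (expMeanLogSU (n := n))) k U₀) (G k) (walk (emb c.src) (stairWord i.2.1 (off i.1))))
            - ((Averaging.iter (fun i => blockAvg (P := P) (j := i) (expMeanLogSU (n := n))) (k + 1) U₀ c : Matrix.specialUnitaryGroup n ℂ) : Matrix n n ℂ)
              * (((Fintype.card (Idx P) : ℂ))⁻¹ • ∑ i : Idx P,
              covWalkSum (Averaging.iter (fun i => blockAvg (P := P) (j := i) (expMeanLogSU (n := n))) k U₀) (G k) (walk (emb c.tgt) (stairWord i.2.1 (off i.1))))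
              * star ((Averaging.iter (fun i => blockAvg (P := P) (j := i) (expMeanLogSU (n := n))) (k + 1) U₀ c : Matrix.specialUnitaryGroup n ℂ) : Matrix n n ℂ))
        + R k c)

include hGs in
/-- ★ **LOCAL ONE-STEP `ℓ¹` ROW OF THE SOURCED REDUCED FAMILY**: at a level `j + 1 ≤ m + K`, for every family `C` of coarse bonds whose background loop variables are within
`α ≤ 1/24` (`0 ≤ α < δ_N`) of `1` and every reading set `S ⊇ ⋃_{c∈C} N(c)`:
`Σ_{c∈C}‖G (j+1) c‖ ≤ ((L^d)⁻¹L + 159·(d+2)L·2d·α)·Σ_{b∈S}‖G j b‖ + Σ_{c∈C}‖R j c‖` (the decomposition `G_{j+1} = Def_jG_j + LINE_jG_j + R_j` and §1).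
1b's ✓`sum_norm_sourcedReduced_succ_le` is `C = univ`, `S = univ`. [cite: Balaban1985Averaging, Prop. 3 (124)-(126) p.36] -/
theorem sum_norm_sourcedReduced_succ_le_local {j : ℕ} (hj1 : j + 1 ≤ P.m + P.K) (C : Finset (PBond P (j + 1))) (S : Finset (PBond P j))
    (hS : ∀ c ∈ C, ∀ b : PBond P j, (blockOf b.src = c.src ∨ blockOf b.src = c.tgt) → b ∈ S) {α : ℝ} (hα0 : 0 ≤ α)
    (hα : ∀ c ∈ C, ∀ i : Idx P,
        dist1 (loopHol (Averaging.iter (fun i => blockAvg (P := P) (j := i) (expMeanLogSU (n := n))) j U₀) c i) ≤ α)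
    (hα24 : α ≤ 1 / 24) (hαN : α < deltaSU n) :
    ∑ c ∈ C, ‖G (j + 1) c‖
      ≤ ((((P.L : ℝ) ^ P.d)⁻¹ * (P.L : ℝ)) + (159 * (((P.d + 2) * P.L : ℕ) : ℝ) * (2 * P.d)) * α) * ∑ b ∈ S, ‖G j b‖ + ∑ c ∈ C, ‖R j c‖ := by
  set V := Averaging.iter (fun i => blockAvg (P := P) (j := i) (expMeanLogSU (n := n))) j U₀ with hV
  set D : PBond P (j + 1) → Matrix n n ℂ := fun c =>
    (fderiv ℂ (eml : (Idx P → Matrix n n ℂ) → Matrix n n ℂ)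
          (fun i => ((loopHol V c i : Matrix.specialUnitaryGroup n ℂ) : Matrix n n ℂ))
          (fun i => covWalkSum V (G j) (walk (emb c.src) (loopWord P.L c.dir (off i.1) i.2.1 i.2.2))
            * ((loopHol V c i : Matrix.specialUnitaryGroup n ℂ) : Matrix n n ℂ))
          * star ((corr (expMeanLogSU (n := n)) V c : Matrix.specialUnitaryGroup n ℂ) : Matrix n n ℂ)
        + ((corr (expMeanLogSU (n := n)) V c : Matrix.specialUnitaryGroup n ℂ) : Matrix n n ℂ)
          * covWalkSum V (G j) (walk (emb c.src) (List.replicate P.L (c.dir, true)))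
          * star ((corr (expMeanLogSU (n := n)) V c : Matrix.specialUnitaryGroup n ℂ) : Matrix n n ℂ))
    - ((((Fintype.card (Idx P) : ℂ))⁻¹ • ∑ i : Idx P,
            covWalkSum V (G j) (walk (emb c.src) (stairWord i.2.1 (off i.1))))
        - ((avgFun (expMeanLogSU (n := n)) V c : Matrix.specialUnitaryGroup n ℂ) : Matrix n n ℂ)
            * (((Fintype.card (Idx P) : ℂ))⁻¹ • ∑ i : Idx P,
            covWalkSum V (G j) (walk (emb c.tgt) (stairWord i.2.1 (off i.1))))
            * star ((avgFun (expMeanLogSU (n := n)) V c : Matrix.specialUnitaryGroup n ℂ) : Matrix n n ℂ))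
    - (((Fintype.card (Idx P) : ℂ))⁻¹ • ∑ i : Idx P,
        ((holAt V (walk (emb c.src) (stairWord i.2.1 (off i.1))) : Matrix.specialUnitaryGroup n ℂ) : Matrix n n ℂ) *
          covWalkSum V (G j) (walk (walkEnd (emb c.src) (stairWord i.2.1 (off i.1))) (List.replicate P.L (c.dir, true))) *
        star ((holAt V (walk (emb c.src) (stairWord i.2.1 (off i.1))) : Matrix.specialUnitaryGroup n ℂ) : Matrix n n ℂ)) with hD
  set LG : PBond P (j + 1) → Matrix n n ℂ := fun c => (((Fintype.card (Idx P) : ℂ))⁻¹ • ∑ i : Idx P,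
        ((holAt V (walk (emb c.src) (stairWord i.2.1 (off i.1))) : Matrix.specialUnitaryGroup n ℂ) : Matrix n n ℂ) *
          covWalkSum V (G j) (walk (walkEnd (emb c.src) (stairWord i.2.1 (off i.1))) (List.replicate P.L (c.dir, true))) *
        star ((holAt V (walk (emb c.src) (stairWord i.2.1 (off i.1))) : Matrix.specialUnitaryGroup n ℂ) : Matrix n n ℂ)) with hLG
  have hiter : Averaging.iter (fun i => blockAvg (P := P) (j := i) (expMeanLogSU (n := n))) (j + 1) U₀ = avgFun (expMeanLogSU (n := n)) V := rfl
  have hdec : ∀ c, G (j + 1) c = (D c + LG c) + R j c := by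
    intro c
    rw [hGs, hiter]
    simp only [hD, hLG]
    abel
  have hDrow : ∑ c ∈ C, ‖D c‖ ≤ 159 * α * (((P.d + 2) * P.L : ℕ) : ℝ) * (2 * P.d) * ∑ b ∈ S, ‖G j b‖ := by
    have h := sum_norm_defect_le_local hj1 V (G j) C S hS hα0 hα hα24 hαN
    simpa only [hD] using h
  have hLGrow : ∑ c ∈ C, ‖LG c‖ ≤ ((P.L : ℝ) ^ P.d)⁻¹ * (P.L : ℝ) * ∑ b ∈ S, ‖G j b‖ := by
    have h := sum_norm_line_le_local hj1 V (G j) C S hS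
    simpa only [hLG] using h
  calc ∑ c ∈ C, ‖G (j + 1) c‖ = ∑ c ∈ C, ‖(D c + LG c) + R j c‖ := by simp only [hdec]
    _ ≤ ∑ c ∈ C, (‖D c‖ + ‖LG c‖ + ‖R j c‖) :=
        Finset.sum_le_sum fun c _ => (norm_add_le _ _).trans (add_le_add (norm_add_le _ _) le_rfl)
    _ = ∑ c ∈ C, ‖D c‖ + ∑ c ∈ C, ‖LG c‖ + ∑ c ∈ C, ‖R j c‖ := by rw [Finset.sum_add_distrib, Finset.sum_add_distrib]
    _ ≤ 159 * α * (((P.d + 2) * P.L : ℕ) : ℝ) * (2 * P.d) * ∑ b ∈ S, ‖G j b‖ + ((P.L : ℝ) ^ P.d)⁻¹ * (P.L : ℝ) * ∑ b ∈ S, ‖G j b‖ + ∑ c ∈ C, ‖R j c‖ :=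
        add_le_add (add_le_add hDrow hLGrow) le_rfl
    _ = _ := by ring

/-! ## §2 ★★ Local propagation of the reduced family along nested bond families -/

include hGs in
/-- ★★ **THE SOURCED REDUCED FAMILY IN `ℓ¹` ON NESTED BOND FAMILIES** (ANY initial value `G 0`).  Let `C_i` (`i ≤ k`) be finite families of level-`i` bonds, NESTED in the
sense that the two-block neighbourhood of every `c ∈ C_{i+1}` lies in `C_i` (`blockOf b₋ ∈ {c₋, c₊} → b ∈ C_i`), and let the background loop variables at the bonds of `C_{i+1}`
be within `a i ≤ 1/24`, `0 ≤ a i < δ_N`, of `1` (`i < k ≤ m + K`).  Then with `ρ₁ = (L^d)⁻¹L`, `κ₁ = 159·(d+2)L·2d`: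
`Σ_{c∈C_k}‖G k c‖ ≤ exp((κ₁/ρ₁)Σ_{i<k} a i)·(ρ₁ᵏ·Σ_{b∈C_0}‖G 0 b‖ + Σ_{i<k} ρ₁^{k−1−i}·Σ_{c∈C_{i+1}}‖R i c‖)` — the SAME damped weights as 1b's global
✓`sum_norm_sourcedReduced_le` (which is `C_i = univ`): the reduced channel is LOCAL. [cite: Balaban1984PropagatorsI, (1.18)-(1.20) pp.19-20; Balaban1985Averaging, Prop. 3 (124)-(126) p.36] -/
theorem sum_norm_sourcedReduced_le_local (a : ℕ → ℝ) (ha0 : ∀ j, 0 ≤ a j) {k : ℕ} (hk : k ≤ P.m + P.K)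
    (C : (i : ℕ) → Finset (PBond P i))
    (hC : ∀ i < k, ∀ c ∈ C (i + 1), ∀ b : PBond P i, (blockOf b.src = c.src ∨ blockOf b.src = c.tgt) → b ∈ C i)
    (hα : ∀ i < k, ∀ c ∈ C (i + 1), ∀ (idx : Idx P),
        dist1 (loopHol (Averaging.iter (fun i => blockAvg (P := P) (j := i) (expMeanLogSU (n := n))) i U₀) c idx) ≤ a i)
    (ha24 : ∀ i < k, a i ≤ 1 / 24) (haN : ∀ i < k, a i < deltaSU n) :
    ∑ c ∈ C k, ‖G k c‖
      ≤ Real.exp ((159 * (((P.d + 2) * P.L : ℕ) : ℝ) * (2 * P.d)) / (((P.L : ℝ) ^ P.d)⁻¹ * (P.L : ℝ)) * ∑ i ∈ Finset.range k, a i)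
        * ((((P.L : ℝ) ^ P.d)⁻¹ * (P.L : ℝ)) ^ k * ∑ b ∈ C 0, ‖G 0 b‖ + ∑ i ∈ Finset.range k, (((P.L : ℝ) ^ P.d)⁻¹ * (P.L : ℝ)) ^ (k - 1 - i) * ∑ c ∈ C (i + 1), ‖R i c‖) := by
  have hLpos : (0 : ℝ) < (P.L : ℝ) := by exact_mod_cast P.L_pos
  have hρpos : (0 : ℝ) < (((P.L : ℝ) ^ P.d)⁻¹ * (P.L : ℝ)) := by positivity
  have hκ0 : (0 : ℝ) ≤ (159 * (((P.d + 2) * P.L : ℕ) : ℝ) * (2 * P.d)) := by positivity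
  have hrows : ∀ i < k, ∑ c ∈ C (i + 1), ‖G (i + 1) c‖
      ≤ ((((P.L : ℝ) ^ P.d)⁻¹ * (P.L : ℝ)) + (159 * (((P.d + 2) * P.L : ℕ) : ℝ) * (2 * P.d)) * a i) * ∑ c ∈ C i, ‖G i c‖ + ∑ c ∈ C (i + 1), ‖R i c‖ :=
    fun i hi => sum_norm_sourcedReduced_succ_le_local U₀ R G hGs (by omega) (C (i + 1)) (C i) (hC i hi) (ha0 i) (hα i hi) (ha24 i hi) (haN i hi)
  exact sourced_recursion_bound_init hρpos hκ0 a (fun i => ∑ c ∈ C i, ‖G i c‖) (fun i => ∑ c ∈ C (i + 1), ‖R i c‖) ha0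
    (fun i => Finset.sum_nonneg fun c _ => norm_nonneg _) (fun i => Finset.sum_nonneg fun c _ => norm_nonneg _) k hrows

end Sourced

/-! ## §3 ★★ The sparse coarse-gauge channel: `Λ_k` on a site family reads `CM_j(G_j)` only on the centre chains -/

section Gauge

variable (U₀ : GaugeField P 0 (Matrix.specialUnitaryGroup n ℂ)) (G : (k : ℕ) → PBond P k → Matrix n n ℂ) (Λ : (k : ℕ) → Site P k → Matrix n n ℂ)
  (hΛ0 : ∀ y, Λ 0 y = 0)
  (hΛs : ∀ (k : ℕ) (z : Site P (k + 1)), Λ (k + 1) z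
    = (((Fintype.card (Idx P) : ℂ))⁻¹ • ∑ i : Idx P,
              covWalkSum (Averaging.iter (fun i => blockAvg (P := P) (j := i) (expMeanLogSU (n := n))) k U₀) (G k) (walk (emb z) (stairWord i.2.1 (off i.1))))
      + Λ k (emb z))

include hΛ0 hΛs in
/-- ★★ **THE SPARSE `ℓ¹` ROW OF THE COARSE GAUGE FUNCTION**: for the recursion of record `Λ_0 = 0`, `Λ_{j+1}(z) = CM_j(G_j)(z) + Λ_j(emb z)`, and ANY site families `S_i`
(`i ≤ k ≤ m + K`) closed under the centre map (`z ∈ S_{i+1} → emb z ∈ S_i`):  `Σ_{y∈S_k}‖Λ_k(y)‖ ≤ Σ_{j<k} Σ_{z∈S_{j+1}} ‖CM_j(G_j)(z)‖` — the level-`k` values on `S_k`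
read the comb means ONLY along the centre chains (`emb` is injective in the standing range), not on all finer sites as in 1b's ✓`sum_norm_sourcedGauge_le`.
[cite: Balaban1984PropagatorsI, (1.18)-(1.20) pp.19-20] -/
theorem sum_norm_sourcedGauge_le_sparse {k : ℕ} (hk : k ≤ P.m + P.K) (S : (i : ℕ) → Finset (Site P i))
    (hS : ∀ i < k, ∀ z ∈ S (i + 1), emb z ∈ S i) :
    ∑ y ∈ S k, ‖Λ k y‖ ≤ ∑ j ∈ Finset.range k, ∑ z ∈ S (j + 1), ‖((Fintype.card (Idx P) : ℂ))⁻¹ • ∑ i : Idx P,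
        covWalkSum (Averaging.iter (fun i => blockAvg (P := P) (j := i) (expMeanLogSU (n := n))) j U₀) (G j) (walk (emb z) (stairWord i.2.1 (off i.1)))‖ := by
  classical
  induction k with
  | zero => simp [hΛ0]
  | succ k ih =>
    have hk' : k ≤ P.m + P.K := Nat.le_of_succ_le hk
    have hinj : Function.Injective (emb : Site P (k + 1) → Site P k) := fun z z' h => by
      rw [← Site.blockOf_emb hk z, ← Site.blockOf_emb hk z', h]
    rw [Finset.sum_range_succ]
    -- one step of the recursion on `S (k+1)`
    have h1 : ∑ y ∈ S (k + 1), ‖Λ (k + 1) y‖ ≤ ∑ y ∈ S (k + 1), ‖((Fintype.card (Idx P) : ℂ))⁻¹ • ∑ i : Idx P,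
          covWalkSum (Averaging.iter (fun i => blockAvg (P := P) (j := i) (expMeanLogSU (n := n))) k U₀) (G k) (walk (emb y) (stairWord i.2.1 (off i.1)))‖
        + ∑ y ∈ S (k + 1), ‖Λ k (emb y)‖ := by
      rw [← Finset.sum_add_distrib]
      exact Finset.sum_le_sum fun y _ => by rw [hΛs]; exact norm_add_le _ _
    -- the centres `emb y`, `y ∈ S (k+1)`, are distinct points of `S k`
    have h2 : ∑ y ∈ S (k + 1), ‖Λ k (emb y)‖ ≤ ∑ z ∈ S k, ‖Λ k z‖ := by
      rw [← Finset.sum_image (f := fun z => ‖Λ k z‖) (fun z _ z' _ h => hinj h)]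
      exact Finset.sum_le_sum_of_subset_of_nonneg (fun z hz => by
        obtain ⟨y, hy, rfl⟩ := Finset.mem_image.1 hz
        exact hS k (Nat.lt_succ_self k) y hy) fun z _ _ => norm_nonneg _
    have h3 := ih hk' (fun i hi => hS i (Nat.lt_succ_of_lt hi))
    linarith

include hΛ0 hΛs in
/-- ★ **THE SPARSE ROW IN BLOCK CURRENCY**: under the same hypotheses, `Σ_{y∈S_k}‖Λ_k(y)‖ ≤ Σ_{j<k} (d+2)L·Σ_{z∈S_{j+1}} Σ_{b : blockOf b₋ = z} ‖G_j(b)‖` — each comb mean reads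
only the bonds issuing from its own block (✓1a `norm_covCombMean_le_block`). [cite: Balaban1984PropagatorsI, (1.18)-(1.20) pp.19-20; Balaban1987RG1, (0.3) p.252] -/
theorem sum_norm_sourcedGauge_le_sparse_blocks {k : ℕ} (hk : k ≤ P.m + P.K) (S : (i : ℕ) → Finset (Site P i))
    (hS : ∀ i < k, ∀ z ∈ S (i + 1), emb z ∈ S i) :
    ∑ y ∈ S k, ‖Λ k y‖ ≤ ∑ j ∈ Finset.range k, (((P.d + 2) * P.L : ℕ) : ℝ) * ∑ z ∈ S (j + 1),
        ∑ b ∈ univ.filter (fun b : PBond P j => blockOf b.src = z), ‖G j b‖ := by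
  refine (sum_norm_sourcedGauge_le_sparse U₀ G Λ hΛ0 hΛs hk S hS).trans (Finset.sum_le_sum fun j hj => ?_)
  have hjk : j < k := Finset.mem_range.mp hj
  rw [Finset.mul_sum]
  exact Finset.sum_le_sum fun z _ => norm_covCombMean_le_block (by omega) _ (G j) z

end Gauge

/-! ## §4 ★★★ The sparse two-channel engine -/

section Assembly

variable (U₀ : GaugeField P 0 (Matrix.specialUnitaryGroup n ℂ)) (R : (k : ℕ) → PBond P (k + 1) → Matrix n n ℂ)
  (D : (k : ℕ) → PBond P k → Matrix n n ℂ)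
  (hDs : ∀ (k : ℕ) (c : PBond P (k + 1)), D (k + 1) c = (fderiv ℂ (eml : (Idx P → Matrix n n ℂ) → Matrix n n ℂ)
            (fun i => ((loopHol (Averaging.iter (fun i => blockAvg (P := P) (j := i) (expMeanLogSU (n := n))) k U₀) c i : Matrix.specialUnitaryGroup n ℂ) : Matrix n n ℂ))
            (fun i => covWalkSum (Averaging.iter (fun i => blockAvg (P := P) (j := i) (expMeanLogSU (n := n))) k U₀) (D k) (walk (emb c.src) (loopWord P.L c.dir (off i.1) i.2.1 i.2.2))
              * ((loopHol (Averaging.iter (fun i => blockAvg (P := P) (j := i) (expMeanLogSU (n := n))) k U₀) c i : Matrix.specialUnitaryGroup n ℂ) : Matrix n n ℂ))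
            * star ((corr (expMeanLogSU (n := n)) (Averaging.iter (fun i => blockAvg (P := P) (j := i) (expMeanLogSU (n := n))) k U₀) c : Matrix.specialUnitaryGroup n ℂ) : Matrix n n ℂ)
          + ((corr (expMeanLogSU (n := n)) (Averaging.iter (fun i => blockAvg (P := P) (j := i) (expMeanLogSU (n := n))) k U₀) c : Matrix.specialUnitaryGroup n ℂ) : Matrix n n ℂ)
            * covWalkSum (Averaging.iter (fun i => blockAvg (P := P) (j := i) (expMeanLogSU (n := n))) k U₀) (D k) (walk (emb c.src) (List.replicate P.L (c.dir, true)))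
            * star ((corr (expMeanLogSU (n := n)) (Averaging.iter (fun i => blockAvg (P := P) (j := i) (expMeanLogSU (n := n))) k U₀) c : Matrix.specialUnitaryGroup n ℂ) : Matrix n n ℂ)) + R k c)
  (G : (k : ℕ) → PBond P k → Matrix n n ℂ) (hG0 : ∀ b, G 0 b = D 0 b)
  (hGs : ∀ (k : ℕ) (c : PBond P (k + 1)), G (k + 1) c
      = (fderiv ℂ (eml : (Idx P → Matrix n n ℂ) → Matrix n n ℂ)
            (fun i => ((loopHol (Averaging.iter (fun i => blockAvg (P := P) (j := i) (expMeanLogSU (n := n))) k U₀) c i : Matrix.specialUnitaryGroup n ℂ) : Matrix n n ℂ))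
            (fun i => covWalkSum (Averaging.iter (fun i => blockAvg (P := P) (j := i) (expMeanLogSU (n := n))) k U₀) (G k) (walk (emb c.src) (loopWord P.L c.dir (off i.1) i.2.1 i.2.2))
              * ((loopHol (Averaging.iter (fun i => blockAvg (P := P) (j := i) (expMeanLogSU (n := n))) k U₀) c i : Matrix.specialUnitaryGroup n ℂ) : Matrix n n ℂ))
            * star ((corr (expMeanLogSU (n := n)) (Averaging.iter (fun i => blockAvg (P := P) (j := i) (expMeanLogSU (n := n))) k U₀) c : Matrix.specialUnitaryGroup n ℂ) : Matrix n n ℂ)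
          + ((corr (expMeanLogSU (n := n)) (Averaging.iter (fun i => blockAvg (P := P) (j := i) (expMeanLogSU (n := n))) k U₀) c : Matrix.specialUnitaryGroup n ℂ) : Matrix n n ℂ)
            * covWalkSum (Averaging.iter (fun i => blockAvg (P := P) (j := i) (expMeanLogSU (n := n))) k U₀) (G k) (walk (emb c.src) (List.replicate P.L (c.dir, true)))
            * star ((corr (expMeanLogSU (n := n)) (Averaging.iter (fun i => blockAvg (P := P) (j := i) (expMeanLogSU (n := n))) k U₀) c : Matrix.specialUnitaryGroup n ℂ) : Matrix n n ℂ))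
        - ((((Fintype.card (Idx P) : ℂ))⁻¹ • ∑ i : Idx P,
              covWalkSum (Averaging.iter (fun i => blockAvg (P := P) (j := i) (expMeanLogSU (n := n))) k U₀) (G k) (walk (emb c.src) (stairWord i.2.1 (off i.1))))
            - ((Averaging.iter (fun i => blockAvg (P := P) (j := i) (expMeanLogSU (n := n))) (k + 1) U₀ c : Matrix.specialUnitaryGroup n ℂ) : Matrix n n ℂ)
              * (((Fintype.card (Idx P) : ℂ))⁻¹ • ∑ i : Idx P,
              covWalkSum (Averaging.iter (fun i => blockAvg (P := P) (j := i) (expMeanLogSU (n := n))) k U₀) (G k) (walk (emb c.tgt) (stairWord i.2.1 (off i.1))))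
              * star ((Averaging.iter (fun i => blockAvg (P := P) (j := i) (expMeanLogSU (n := n))) (k + 1) U₀ c : Matrix.specialUnitaryGroup n ℂ) : Matrix n n ℂ))
        + R k c)
  (Λ : (k : ℕ) → Site P k → Matrix n n ℂ) (hΛ0 : ∀ y, Λ 0 y = 0)
  (hΛs : ∀ (k : ℕ) (z : Site P (k + 1)), Λ (k + 1) z
    = (((Fintype.card (Idx P) : ℂ))⁻¹ • ∑ i : Idx P,
              covWalkSum (Averaging.iter (fun i => blockAvg (P := P) (j := i) (expMeanLogSU (n := n))) k U₀) (G k) (walk (emb z) (stairWord i.2.1 (off i.1))))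
      + Λ k (emb z))

include hDs hG0 hGs hΛ0 hΛs in
/-- ★★★ **THE SPARSE TWO-CHANNEL `ℓ¹` ENGINE** (ANY initial field `D_0`).  `D_{j+1} = T_jD_j + R_j` along the tower `Ū₀^{(j)}` (`k ≤ m + K`); `G` (`G_0 = D_0`), `Λ` the sourced
reduced family and the coarse gauge function of record (✓A1); per-level loop sizes `dist1(W^{(j)}_i(c)) ≤ a j ≤ 1/24`, `0 ≤ a j < δ_N` (`j < k`, all coarse bonds); `S_i` ANY site
families closed under the centre map with `S_k = univ` (the centre chains of the level-`k` sites).  Then with `ρ₁ = (L^d)⁻¹L`, `κ₁ = 159·(d+2)L·2d`, `E_k = exp((κ₁/ρ₁)Σ_{i<k}a i)`: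
`Σ_c‖D k c‖ ≤ E_k·(ρ₁ᵏ·Σ_b‖D 0 b‖ + Σ_{i<k}ρ₁^{k−1−i}Σ_c‖R i c‖) + 2d·Σ_{j<k}(d+2)L·Σ_{z∈S_{j+1}}Σ_{b : blockOf b₋ = z}‖G j b‖` — the mass channel is 1b's VERBATIM, the coarse-gauge
channel reads the reduced family only on the blocks under the centre chains; §2 bounds each block term by the sources on any nested bond family around that block.
[cite: Balaban1984PropagatorsI, (1.18)-(1.20) pp.19-20; Balaban1985Averaging, Prop. 3 (124)-(126) p.36] -/
theorem sum_norm_sourced_le_sparse (a : ℕ → ℝ) (ha0 : ∀ j, 0 ≤ a j) {k : ℕ} (hk : k ≤ P.m + P.K)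
    (hα : ∀ j < k, ∀ (c : PBond P (j + 1)) (i : Idx P),
        dist1 (loopHol (Averaging.iter (fun i => blockAvg (P := P) (j := i) (expMeanLogSU (n := n))) j U₀) c i) ≤ a j)
    (ha24 : ∀ j < k, a j ≤ 1 / 24) (haN : ∀ j < k, a j < deltaSU n)
    (S : (i : ℕ) → Finset (Site P i)) (hS : ∀ i < k, ∀ z ∈ S (i + 1), emb z ∈ S i) (hSk : S k = univ) :
    ∑ c : PBond P k, ‖D k c‖
      ≤ Real.exp ((159 * (((P.d + 2) * P.L : ℕ) : ℝ) * (2 * P.d)) / (((P.L : ℝ) ^ P.d)⁻¹ * (P.L : ℝ)) * ∑ i ∈ Finset.range k, a i)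
          * ((((P.L : ℝ) ^ P.d)⁻¹ * (P.L : ℝ)) ^ k * (∑ b : PBond P 0, ‖D 0 b‖) + (∑ i ∈ Finset.range k, (((P.L : ℝ) ^ P.d)⁻¹ * (P.L : ℝ)) ^ (k - 1 - i) * ∑ c : PBond P (i + 1), ‖R i c‖))
        + 2 * P.d * ∑ j ∈ Finset.range k, (((P.d + 2) * P.L : ℕ) : ℝ) * ∑ z ∈ S (j + 1),
            ∑ b ∈ univ.filter (fun b : PBond P j => blockOf b.src = z), ‖G j b‖ := by
  -- the (0.4) guards from the loop sizes
  have hg : ∀ j < k, ∀ (c : PBond P (j + 1)) (i : Idx P),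
      dist1 (loopHol (Averaging.iter (fun i => blockAvg (P := P) (j := i) (expMeanLogSU (n := n))) j U₀) c i) < deltaSU n :=
    fun j hj c i => (hα j hj c i).trans_lt (haN j hj)
  -- pointwise split `D = G + P Λ`
  have hpt : ∀ c : PBond P k, ‖D k c‖ ≤ ‖G k c‖ + (‖Λ k c.tgt‖ + ‖Λ k c.src‖) := fun c => by
    have h := norm_le_of_sourced_structure U₀ D R hDs
      (fun k Gk z => ((Fintype.card (Idx P) : ℂ))⁻¹ • ∑ i : Idx P,
        covWalkSum (Averaging.iter (fun i => blockAvg (P := P) (j := i) (expMeanLogSU (n := n))) k U₀) Gk (walk (emb z) (stairWord i.2.1 (off i.1))))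
      G Λ hG0 hΛ0 hΛs hGs hg c
    linarith
  have h1 : ∑ c : PBond P k, ‖D k c‖ ≤ ∑ c : PBond P k, ‖G k c‖ + 2 * P.d * ∑ y : Site P k, ‖Λ k y‖ := by
    calc ∑ c : PBond P k, ‖D k c‖ ≤ ∑ c : PBond P k, (‖G k c‖ + (‖Λ k c.tgt‖ + ‖Λ k c.src‖)) := Finset.sum_le_sum fun c _ => hpt c
      _ = ∑ c : PBond P k, ‖G k c‖ + 2 * P.d * ∑ y : Site P k, ‖Λ k y‖ := by
          rw [Finset.sum_add_distrib, sum_pbond_tgt_add_src (fun y => ‖Λ k y‖)]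
  -- the mass channel (1b verbatim)
  have hG0sum : ∑ b : PBond P 0, ‖G 0 b‖ = (∑ b : PBond P 0, ‖D 0 b‖) := Finset.sum_congr rfl fun b _ => by rw [hG0]
  have hG := sum_norm_sourcedReduced_le U₀ R G hGs a ha0 hk hα ha24 haN
  rw [hG0sum] at hG
  -- the sparse coarse-gauge channel
  have hΛ := sum_norm_sourcedGauge_le_sparse_blocks U₀ G Λ hΛ0 hΛs hk S hS
  rw [hSk] at hΛ
  have hd0 : (0 : ℝ) ≤ 2 * P.d := by positivity
  have := mul_le_mul_of_nonneg_left hΛ hd0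
  linarith [h1, hG, this]

end Assembly

end Summit.QuantumFields.YangMills.Theorems.Prop7TrueLinSourcedSparseL1

end
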